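import Summits.QuantumFields.YangMills.Theorems.BalabanUVNodesN21ResponseRoadAtRegularSet
import Summits.QuantumFields.BalabanUV.T4Continuum.Support.ShellMeasureExpChartSUN

/-!
# N21 (NE7c) · the response road's exponential block chart IS the lane's `SU(N)` block chart of record: the
# identity `updateFinset xext Λ (expFibreChartSU Λ u₀ x) = (bond ↦ exp(Σ_i x_i•X_i(bond))·V₀(bond))` and its chart
# letters `Ξ_N`, `v = v′ = 1` — file 7∕8's field-strength letter read AT `expFibreChartSU` (W-SEAT START-LIST v8 §n21)

Width seat `pub-ymgap-dag-n21-w3` (g2), node N21 = NE7c (NOT PRINTED in [Bałaban 1983–89], NOT proved), lane K3⁷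
`SpineGivenEndpointR13SepCoPH` (stmt-QuantumFields-20544, `--kind proof --supports … --as helper`).  File 10 of this
seat's response road; consumes BY NAME file 8 `…N21ResponseRoadAtRegularSet` (★
`fieldStrength_closedBall_blockExpChart_of_norm_le`), pub-balaban's `ShellMeasureExpChartSUN` (p208431∕p209873: `genSU`,
`expPtSU`, `expFibreChartSU`, `BlockChartSU`, `dimSU`) and the tree's `T4AdjointCovarianceUnitary` (`toUnitary`,
`exp_conj_unitary` = [B2] (57) «`R(u)f(Y) = f(R(u)Y)`», `opNorm_conj_unitary`); Mathlib's C⋆-norm on matrices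
(scope `Matrix.Norms.L2Operator`, the tree's standing choice), `EuclideanSpace.basisFun`, `Unitary.toUnits`.

WHY.  Files 5–9 speak of an ABSTRACT exponential block chart `χ(w) = (b ↦ exp(Σ_a w_a•X_a(b))·V₀(b))` on a complete
normed `ℂ`-algebra.  The N21 lane's chart OF RECORD for the block fibre law (`…N21ShellSplitOfRecord13CoPHDefs`
`blockFibreLawOfDatum₉ … b x` on `↥b → SU(N)`, its statistics `blockReading u b x = u ∘ updateFinset x b`; dag-n21-w2
JUNCTION №3 `hchart` on the flat block chart space) is pub-balaban's `expFibreChartSU Λ u₀ : BlockChartSU N Λ → (↥Λ →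
SU(N))`, `x ↦ (b ↦ u₀ b · exp (genSU (x b)))`, the block variables then written into the exterior field by
`Function.updateFinset`.  THIS FILE proves the two are THE SAME OBJECT: with block coordinates `κ = ↥Λ × Fin d_N`
(`d_N = dim 𝔰𝔲(N)`), directions `X_{(b′,a)}(bond) = 𝟙_{bond = b′}·Ad_{u₀ b′}(T_a)` (`T_a = genSU (e_a)` the image of
the `a`-th orthonormal coordinate vector; `Ad_u T = uTu*`) and base configuration `V₀ = updateFinset xext Λ u₀` (units
of the matrix algebra), for every REAL chart point `x`
`updateFinset xext Λ (expFibreChartSU Λ u₀ x) bond = exp(Σ_i x_{i}•X_i(bond)) · V₀(bond)` for EVERY bond (block or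
exterior) — by `u·exp(Y)·u* = exp(uYu*)` and `u*u = 1`.  Its chart letters are FORMULAS: `Σ_i ‖X_i(bond)‖ ≤ Ξ_N :=
Σ_a ‖T_a‖` (equality on block bonds by unitary invariance of the C⋆-norm, `0` off the block), `‖V₀(bond)‖ = 1`,
`‖V₀(bond)⁻¹‖ = 1` (unitary).  Hence file 8's ★ field-strength letter holds VERBATIM for the full configuration of
record about any real chart point (§3), with `v = v′ = 1`, `Ξ = Ξ_N`: the response road's chart-side letters are now
typed AT the lane's objects, not at a model of them; its complexification (`w : κ → ℂ`) is the road's analytic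
continuation of the same chart.

WHAT IS PROVED ([textbook]∕[bookkeeping]; 0 def, 0 sorry; `N` with `NeZero N` where the C⋆-norm needs `‖1‖ = 1`;
`[DecidableEq (PBond P j)]` for `updateFinset` as in pub-balaban's realized headlines).
* §1 `genSU_eq_sum_coord` (`genSU v = Σ_a (v_a : ℂ)•T_a`), `sum_coord_smul_conj` (`Σ_a (v_a : ℂ)•(uT_au*) = u·genSU v·u*`),
  ★ `updateFinset_expFibreChartSU_eq_blockExpChart` (the identity above, every bond).
* §2 `sum_norm_blockDir_le` (`Σ_i ‖X_i(bond)‖ ≤ Ξ_N`), `norm_baseUnit_le_one`, `norm_inv_baseUnit_le_one`.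
* §3 ★★ `fieldStrength_closedBall_expFibreChartSU`: file 8 ★ at the lane's chart — every configuration
  `V : PBond → M_N(ℂ)` in the bond-sup ball of radius `R` about the full configuration of record
  `updateFinset xext Λ (expFibreChartSU Λ u₀ x)` (`‖x‖_flat ≤ ϱ`, `R·e^{ϱΞ_N} ≤ ½`, base field strength `≤ δ` on
  `plaqs`) has unit bond variables and `‖∂V(p) − 1‖ ≤ δ + max(e^{ϱΞ_N} + R, 2e^{ϱΞ_N})³(2 + 4e^{2ϱΞ_N})·R` on `plaqs`.
* §4 A2∕A6 `smallness_letter_inhabited`: for every `ϱ` the smallness letter of §3 is met by `R = ½e^{−ϱΞ_N}`.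
* §5 `unflat_apply`, ★ `updateFinset_expFibreChartSU_unflat_eq_blockExpChart`: the same identity at the block chart
  point with prescribed FLAT real coordinates `y : ↥Λ × Fin d_N → ℝ` — the frame `κ → ℝ` of file 8's ★★★∕★★★★, so
  their tested variable ∕ `hreg` ∕ `hc₀` with `Xd z := X(u₀ z)`, `V₀ z := updateFinset z Λ (u₀ z)` read the record's
  configuration `updateFinset z Λ (expFibreChartSU Λ (u₀ z) ·)` with no model in between.

HONEST FRAMING.  [textbook]∕[bookkeeping] identity and letters; the chart `expFibreChartSU` is pub-balaban's object
(credited), the identification with print's charts (1.12)–(1.13) ∕ (2.21) stays a located DICTIONARY; nothing of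
Bałaban's asserted; (M1) ∕ NE7c NOT PRINTED ∕ NOT proved; N21 NOT discharged; K3⁷ NOT claimed; counts unmoved (typed
28∕28 · discharged 5∕27); count-neutral; one finite 𝕋⁴ at fixed ε — YM mass gap (Clay) is NOT proved by any of this:
R4 closes the conditional finite-𝕋⁴ rung `BalabanLadder.UV` only; nothing continuum ∕ ℝ⁴ ∕ OS ∕ mass gap ∕ Clay.
-/

open scoped Matrix.Norms.L2Operator

noncomputable section

open NormedSpace Metric Set

namespace Summit.QuantumFields.YangMills.Theorems.N21ResponseRoadAtSUNBlockChart

open Summit.QuantumFields.BalabanUV.T4Continuum.ShellMeasureExpChartSUN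
open Literature.MathematicalPhysics.QuantumFieldTheory.Balaban1983to89
open T4AdjointCovarianceUnitary (lieSU toUnitary coe_toUnitary exp_conj_unitary opNorm_conj_unitary)
open Summit.QuantumFields.YangMills.Theorems.N21ResponseRoadAtRegularSet
  (fieldStrength_closedBall_blockExpChart_of_norm_le)

variable {N : ℕ} {P : Params} {j : ℕ} [DecidableEq (PBond P j)]

/-! ## §1  The `SU(N)` block chart of record is an exponential block chart of the response road -/

omit [DecidableEq (PBond P j)] in
/-- the generator expands along the orthonormal coordinates, complexified: `genSU v = Σ_a (v_a : ℂ) • T_a`,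
`T_a = genSU (e_a)`. [textbook] -/
theorem genSU_eq_sum_coord (v : ChartSU N) :
    genSU v = ∑ a, ((v a : ℝ) : ℂ) • genSU (EuclideanSpace.single a (1 : ℝ)) := by
  conv_lhs => rw [← (EuclideanSpace.basisFun (Fin (dimSU N)) ℝ).sum_repr v]
  simp only [EuclideanSpace.basisFun_repr, EuclideanSpace.basisFun_apply, genSU, map_sum, map_smul,
    Submodule.coe_sum, Submodule.coe_smul, Complex.coe_smul]

omit [DecidableEq (PBond P j)] in
/-- the conjugated directions sum to the conjugated generator: `Σ_a (v_a : ℂ) • (u·T_a·u*) = u · genSU v · u*`.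
[textbook] -/
theorem sum_coord_smul_conj (u : Matrix (Fin N) (Fin N) ℂ) (v : ChartSU N) :
    ∑ a, ((v a : ℝ) : ℂ) • (u * genSU (EuclideanSpace.single a (1 : ℝ)) * star u) = u * genSU v * star u := by
  rw [genSU_eq_sum_coord, Finset.mul_sum, Finset.sum_mul]
  refine Finset.sum_congr rfl fun a _ => ?_
  rw [Matrix.mul_smul, Matrix.smul_mul]

/-- ★ **THE `SU(N)` BLOCK CHART OF RECORD IS THE RESPONSE ROAD's EXPONENTIAL BLOCK CHART.**  For every bond
(block or exterior), the full configuration of record `updateFinset xext Λ (expFibreChartSU Λ u₀ x)` at the REAL chart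
point `x` equals `exp(Σ_i x_i • X_i(bond)) · V₀(bond)` with block coordinates `i = (b′, a) : ↥Λ × Fin d_N`,
directions `X_i(bond) = 𝟙_{bond = b′}·(u₀ b′)·T_a·(u₀ b′)*` and base `V₀ = updateFinset xext Λ u₀` — by
`u·exp(Y)·u* = exp(uYu*)` ([B2] (57); tree `exp_conj_unitary`) and `u*u = 1`. [textbook] -/
theorem updateFinset_expFibreChartSU_eq_blockExpChart (Λ : Finset (PBond P j)) (u₀ xext : GaugeField P j (SUN N))
    (x : BlockChartSU N Λ) (bond : PBond P j) :
    ((Function.updateFinset xext Λ (expFibreChartSU Λ u₀ x) bond : SUN N) : Matrix (Fin N) (Fin N) ℂ) =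
      exp (∑ i : ↥Λ × Fin (dimSU N), ((x i.1 i.2 : ℝ) : ℂ) •
        (if bond = (i.1 : PBond P j) then
          (u₀ i.1 : Matrix (Fin N) (Fin N) ℂ) * genSU (EuclideanSpace.single i.2 (1 : ℝ)) *
            star (u₀ i.1 : Matrix (Fin N) (Fin N) ℂ) else 0)) *
      ((Unitary.toUnits (toUnitary (Function.updateFinset xext Λ (fun b' : ↥Λ => u₀ (b' : PBond P j)) bond)) :
        (Matrix (Fin N) (Fin N) ℂ)ˣ) : Matrix (Fin N) (Fin N) ℂ) := by
  rw [Unitary.val_toUnits_apply, coe_toUnitary]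
  by_cases hb : bond ∈ Λ
  · -- a block bond `bond = ↑b`
    set b : ↥Λ := ⟨bond, hb⟩ with hb_def
    have hbond : bond = (b : PBond P j) := rfl
    have hsum : (∑ i : ↥Λ × Fin (dimSU N), ((x i.1 i.2 : ℝ) : ℂ) •
        (if bond = (i.1 : PBond P j) then
          (u₀ i.1 : Matrix (Fin N) (Fin N) ℂ) * genSU (EuclideanSpace.single i.2 (1 : ℝ)) *
            star (u₀ i.1 : Matrix (Fin N) (Fin N) ℂ) else 0)) =
        (u₀ b : Matrix (Fin N) (Fin N) ℂ) * genSU (x b) * star (u₀ b : Matrix (Fin N) (Fin N) ℂ) := by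
      rw [Fintype.sum_prod_type, ← sum_coord_smul_conj, Finset.sum_eq_single b]
      · simp [hbond]
      · intro b' _ hb'
        have hne : ¬ (bond = (b' : PBond P j)) := fun h => hb' (Subtype.ext h).symm
        simp only [hne, if_false, smul_zero, Finset.sum_const_zero]
      · simp
    have hexp := exp_conj_unitary (toUnitary (u₀ b)) (genSU (x b))
    rw [coe_toUnitary] at hexp
    rw [hsum, hexp]
    simp only [Function.updateFinset, hb, dif_pos, expFibreChartSU_apply, Submonoid.coe_mul, coe_expPtSU]
    rw [Matrix.mul_assoc ((u₀ b : Matrix (Fin N) (Fin N) ℂ) * exp (genSU (x b))),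
      Unitary.star_mul_self_of_mem (u₀ b).2.1, Matrix.mul_one]
  · -- an exterior bond: no direction touches it
    have hsum : (∑ i : ↥Λ × Fin (dimSU N), ((x i.1 i.2 : ℝ) : ℂ) •
        (if bond = (i.1 : PBond P j) then
          (u₀ i.1 : Matrix (Fin N) (Fin N) ℂ) * genSU (EuclideanSpace.single i.2 (1 : ℝ)) *
            star (u₀ i.1 : Matrix (Fin N) (Fin N) ℂ) else 0)) = 0 := by
      refine Finset.sum_eq_zero fun i _ => ?_
      have hne : ¬ (bond = (i.1 : PBond P j)) := fun h => hb (h ▸ i.1.2)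
      rw [if_neg hne, smul_zero]
    rw [hsum, exp_zero, Matrix.one_mul]
    simp only [Function.updateFinset, hb, dif_neg, not_false_eq_true]

/-! ## §2  The chart letters: `Ξ_N`, `v = v′ = 1` -/

/-- **THE DIRECTION LETTER `Ξ_N = Σ_a ‖T_a‖`**: on a block bond `Σ_i ‖X_i(bond)‖ = Σ_a ‖(u₀ b)T_a(u₀ b)*‖ = Σ_a ‖T_a‖`
(unitary invariance of the C⋆-norm, tree `opNorm_conj_unitary`), on an exterior bond the sum is `0`. [textbook] -/
theorem sum_norm_blockDir_le (Λ : Finset (PBond P j)) (u₀ : GaugeField P j (SUN N)) (bond : PBond P j) :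
    ∑ i : ↥Λ × Fin (dimSU N), ‖(if bond = (i.1 : PBond P j) then
        (u₀ i.1 : Matrix (Fin N) (Fin N) ℂ) * genSU (EuclideanSpace.single i.2 (1 : ℝ)) *
          star (u₀ i.1 : Matrix (Fin N) (Fin N) ℂ) else 0)‖ ≤
      ∑ a : Fin (dimSU N), ‖genSU (EuclideanSpace.single a (1 : ℝ))‖ := by
  by_cases hb : bond ∈ Λ
  · set b : ↥Λ := ⟨bond, hb⟩
    have hbond : bond = (b : PBond P j) := rfl
    rw [Fintype.sum_prod_type, Finset.sum_eq_single b]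
    · refine le_of_eq (Finset.sum_congr rfl fun a _ => ?_)
      rw [if_pos hbond]
      have h := opNorm_conj_unitary (toUnitary (u₀ b)) (genSU (EuclideanSpace.single a (1 : ℝ)))
      rwa [coe_toUnitary] at h
    · intro b' _ hb'
      have hne : ¬ (bond = (b' : PBond P j)) := fun h => hb' (Subtype.ext h).symm
      simp only [hne, if_false, norm_zero, Finset.sum_const_zero]
    · simp
  · have h0 : ∑ i : ↥Λ × Fin (dimSU N), ‖(if bond = (i.1 : PBond P j) then
        (u₀ i.1 : Matrix (Fin N) (Fin N) ℂ) * genSU (EuclideanSpace.single i.2 (1 : ℝ)) *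
          star (u₀ i.1 : Matrix (Fin N) (Fin N) ℂ) else 0)‖ = 0 := by
      refine Finset.sum_eq_zero fun i _ => ?_
      have hne : ¬ (bond = (i.1 : PBond P j)) := fun h => hb (h ▸ i.1.2)
      rw [if_neg hne, norm_zero]
    rw [h0]
    exact Finset.sum_nonneg fun a _ => norm_nonneg _

/-- `‖V₀(bond)‖ ≤ 1`: the base bond variables are (special) unitary, of C⋆-norm `1` (`N ≥ 1`). [textbook] -/
theorem norm_baseUnit_le_one [NeZero N] (Λ : Finset (PBond P j)) (u₀ xext : GaugeField P j (SUN N))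
    (bond : PBond P j) :
    ‖((Unitary.toUnits (toUnitary (Function.updateFinset xext Λ (fun b' : ↥Λ => u₀ (b' : PBond P j)) bond)) :
        (Matrix (Fin N) (Fin N) ℂ)ˣ) : Matrix (Fin N) (Fin N) ℂ)‖ ≤ 1 := by
  rw [Unitary.val_toUnits_apply, coe_toUnitary]
  exact (CStarRing.norm_of_mem_unitary (Function.updateFinset xext Λ (fun b' : ↥Λ => u₀ (b' : PBond P j)) bond).2.1).le

/-- `‖V₀(bond)⁻¹‖ ≤ 1`: the inverse of a unitary is unitary. [textbook] -/
theorem norm_inv_baseUnit_le_one [NeZero N] (Λ : Finset (PBond P j)) (u₀ xext : GaugeField P j (SUN N))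
    (bond : PBond P j) :
    ‖((((Unitary.toUnits (toUnitary (Function.updateFinset xext Λ (fun b' : ↥Λ => u₀ (b' : PBond P j)) bond)))⁻¹ :
        (Matrix (Fin N) (Fin N) ℂ)ˣ)) : Matrix (Fin N) (Fin N) ℂ)‖ ≤ 1 := by
  rw [← map_inv, Unitary.val_toUnits_apply]
  exact (CStarRing.norm_of_mem_unitary
    (toUnitary (Function.updateFinset xext Λ (fun b' : ↥Λ => u₀ (b' : PBond P j)) bond))⁻¹.2).le

/-! ## §3  File 8's field-strength letter AT the `SU(N)` block chart of record -/

omit [DecidableEq (PBond P j)] in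
/-- `0 ≤ Ξ_N`. [bookkeeping] -/
theorem dirLetter_nonneg : 0 ≤ (∑ a : Fin (dimSU N), ‖genSU (EuclideanSpace.single a (1 : ℝ))‖) :=
  Finset.sum_nonneg fun _ _ => norm_nonneg _

/-- ★★ **THE FIELD-STRENGTH LETTER OF THE RESPONSE ROAD AT THE LANE's `SU(N)` BLOCK CHART** (file 8 ★
`fieldStrength_closedBall_blockExpChart_of_norm_le` with `X`, `V₀` := the directions and base of §1, `Ξ := Ξ_N`,
`v = v′ = 1` by §2, the chart identity of §1): about the full configuration of record
`updateFinset xext Λ (expFibreChartSU Λ u₀ x)` at a real chart point with flat coordinate bound `‖x‖_flat ≤ ϱ`, if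
`R·e^{ϱΞ_N} ≤ ½` and the configuration is `δ`-regular on `plaqs`, then every `V : PBond → M_N(ℂ)` of the bond-sup
ball of radius `R` about it has unit bond variables and is `(δ + c̄·R)`-regular on `plaqs`,
`c̄ = max(e^{ϱΞ_N} + R, 2e^{ϱΞ_N})³(2 + 4e^{2ϱΞ_N})`. [textbook] -/
theorem fieldStrength_closedBall_expFibreChartSU [NeZero N] (Λ : Finset (PBond P j))
    (u₀ xext : GaugeField P j (SUN N)) (x : BlockChartSU N Λ) {ϱ R δ : ℝ}
    (hx : ‖(fun i : ↥Λ × Fin (dimSU N) => ((x i.1 i.2 : ℝ) : ℂ))‖ ≤ ϱ)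
    (hR : R * (1 * Real.exp (ϱ * (∑ a : Fin (dimSU N), ‖genSU (EuclideanSpace.single a (1 : ℝ))‖))) ≤ 1 / 2)
    (plaqs : Finset (PBond P j × PBond P j × PBond P j × PBond P j))
    (hδ : ∀ p ∈ plaqs, ‖((Function.updateFinset xext Λ (expFibreChartSU Λ u₀ x) p.1 : SUN N) : Matrix (Fin N) (Fin N) ℂ) * ((Function.updateFinset xext Λ (expFibreChartSU Λ u₀ x) p.2.1 : SUN N) : Matrix (Fin N) (Fin N) ℂ) *
        Ring.inverse ((Function.updateFinset xext Λ (expFibreChartSU Λ u₀ x) p.2.2.1 : SUN N) : Matrix (Fin N) (Fin N) ℂ) * Ring.inverse ((Function.updateFinset xext Λ (expFibreChartSU Λ u₀ x) p.2.2.2 : SUN N) : Matrix (Fin N) (Fin N) ℂ) - 1‖ ≤ δ) :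
    ∀ V ∈ closedBall (fun bond => ((Function.updateFinset xext Λ (expFibreChartSU Λ u₀ x) bond : SUN N) : Matrix (Fin N) (Fin N) ℂ)) R,
      (∀ bond, IsUnit (V bond)) ∧ ∀ p ∈ plaqs,
        ‖V p.1 * V p.2.1 * Ring.inverse (V p.2.2.1) * Ring.inverse (V p.2.2.2) - 1‖ ≤
          δ + max (Real.exp (ϱ * (∑ a : Fin (dimSU N), ‖genSU (EuclideanSpace.single a (1 : ℝ))‖)) * 1 + R) (2 * (1 * Real.exp (ϱ * (∑ a : Fin (dimSU N), ‖genSU (EuclideanSpace.single a (1 : ℝ))‖)))) ^ 3 *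
            (2 + 4 * (1 * Real.exp (ϱ * (∑ a : Fin (dimSU N), ‖genSU (EuclideanSpace.single a (1 : ℝ))‖))) ^ 2) * R := by
  have key : (fun bond => ((Function.updateFinset xext Λ (expFibreChartSU Λ u₀ x) bond : SUN N) : Matrix (Fin N) (Fin N) ℂ)) =
      fun bond => exp (∑ i : ↥Λ × Fin (dimSU N), (fun i : ↥Λ × Fin (dimSU N) => ((x i.1 i.2 : ℝ) : ℂ)) i •
        (fun (i : ↥Λ × Fin (dimSU N)) (bond : PBond P j) => if bond = (i.1 : PBond P j) then
          (u₀ i.1 : Matrix (Fin N) (Fin N) ℂ) * genSU (EuclideanSpace.single i.2 (1 : ℝ)) *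
            star (u₀ i.1 : Matrix (Fin N) (Fin N) ℂ) else 0) i bond) *
        ((fun bond => Unitary.toUnits (toUnitary
          (Function.updateFinset xext Λ (fun b' : ↥Λ => u₀ (b' : PBond P j)) bond))) bond :
            (Matrix (Fin N) (Fin N) ℂ)ˣ) := by
    funext bond
    exact updateFinset_expFibreChartSU_eq_blockExpChart Λ u₀ xext x bond
  simp only [updateFinset_expFibreChartSU_eq_blockExpChart] at hδ
  rw [key]
  exact fieldStrength_closedBall_blockExpChart_of_norm_le (𝔄 := Matrix (Fin N) (Fin N) ℂ)
    (fun (i : ↥Λ × Fin (dimSU N)) (bond : PBond P j) => if bond = (i.1 : PBond P j) then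
      (u₀ i.1 : Matrix (Fin N) (Fin N) ℂ) * genSU (EuclideanSpace.single i.2 (1 : ℝ)) *
        star (u₀ i.1 : Matrix (Fin N) (Fin N) ℂ) else 0)
    (fun bond => Unitary.toUnits (toUnitary
      (Function.updateFinset xext Λ (fun b' : ↥Λ => u₀ (b' : PBond P j)) bond)))
    dirLetter_nonneg (sum_norm_blockDir_le Λ u₀) (norm_baseUnit_le_one Λ u₀ xext)
    (norm_inv_baseUnit_le_one Λ u₀ xext) hx hR plaqs hδ

/-! ## §4  A2∕A6: the smallness letter is met -/

omit [DecidableEq (PBond P j)] in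
/-- **A2∕A6 — THE SMALLNESS LETTER OF §3 IS INHABITED** for every coordinate bound `ϱ`: `R = ½e^{−ϱΞ_N}` gives
`R·e^{ϱΞ_N} = ½`; the other hypotheses of §3 are data (`δ` := the configuration's own field strength). [bookkeeping] -/
theorem smallness_letter_inhabited (ϱ : ℝ) :
    1 / 2 * Real.exp (-(ϱ * (∑ a : Fin (dimSU N), ‖genSU (EuclideanSpace.single a (1 : ℝ))‖))) * (1 * Real.exp (ϱ * (∑ a : Fin (dimSU N), ‖genSU (EuclideanSpace.single a (1 : ℝ))‖))) ≤ 1 / 2 := by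
  rw [one_mul, mul_assoc, ← Real.exp_add, neg_add_cancel, Real.exp_zero, mul_one]

/-! ## §5  Flat real chart points: the dictionary for file 8's ★★★∕★★★★ (frame `κ → ℝ`, `κ = ↥Λ × Fin d_N`) -/

omit [DecidableEq (PBond P j)] in
/-- the block chart point with prescribed flat coordinates `y : ↥Λ × Fin d_N → ℝ` has those coordinates. [bookkeeping] -/
theorem unflat_apply (Λ : Finset (PBond P j)) (y : ↥Λ × Fin (dimSU N) → ℝ) (i : ↥Λ × Fin (dimSU N)) :
    ((fun b' : ↥Λ => (WithLp.toLp 2 fun a : Fin (dimSU N) => y (b', a) : ChartSU N)) i.1) i.2 = y i := by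
  simp

/-- ★ **THE DICTIONARY AT FLAT REAL POINTS** (the frame of file 8's ★★★∕★★★★, `κ = ↥Λ × Fin d_N`): for flat
coordinates `y`, the full configuration of record through the block chart point `(b′ ↦ (y(b′, a))_a)` is bondwise
`exp(Σ_i (y_i : ℂ) • X_i(bond)) · V₀(bond)` — so ★★★'s tested variable, base regularity `hreg` and core reading `hc₀`,
written with `Xd z := X(u₀ z)`, `V₀ z := updateFinset z Λ (u₀ z)`, ARE the record's
`Ψ q z (updateFinset z Λ (expFibreChartSU Λ (u₀ z) ·))` read at the chart point with coordinates `y`. [bookkeeping] -/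
theorem updateFinset_expFibreChartSU_unflat_eq_blockExpChart (Λ : Finset (PBond P j))
    (u₀ xext : GaugeField P j (SUN N)) (y : ↥Λ × Fin (dimSU N) → ℝ) (bond : PBond P j) :
    ((Function.updateFinset xext Λ (expFibreChartSU Λ u₀
        (fun b' : ↥Λ => (WithLp.toLp 2 fun a : Fin (dimSU N) => y (b', a) : ChartSU N))) bond : SUN N) :
        Matrix (Fin N) (Fin N) ℂ) =
      exp (∑ i : ↥Λ × Fin (dimSU N), ((y i : ℝ) : ℂ) •
        (if bond = (i.1 : PBond P j) then
          (u₀ i.1 : Matrix (Fin N) (Fin N) ℂ) * genSU (EuclideanSpace.single i.2 (1 : ℝ)) *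
            star (u₀ i.1 : Matrix (Fin N) (Fin N) ℂ) else 0)) *
      ((Unitary.toUnits (toUnitary (Function.updateFinset xext Λ (fun b' : ↥Λ => u₀ (b' : PBond P j)) bond)) :
        (Matrix (Fin N) (Fin N) ℂ)ˣ) : Matrix (Fin N) (Fin N) ℂ) := by
  rw [updateFinset_expFibreChartSU_eq_blockExpChart]

/-- **THE CHART CENTRE IS THE DATA**: at flat coordinates `y = 0` the configuration of record through the chart is the
base configuration `updateFinset xext Λ u₀` itself (`expPtSU 0 = 1`) — so the base regularity `δ₀` AT THE CENTRE of
file 9's `baseRegularity_of_centre` is the field strength of the DATA (`u₀` on the block, `xext` outside): the located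
reading (L1)∕(L3) «the data in the cut are `ε₁`-regular» is read at the record's configuration, not at a model.
[bookkeeping] -/
theorem updateFinset_expFibreChartSU_unflat_zero (Λ : Finset (PBond P j)) (u₀ xext : GaugeField P j (SUN N))
    (bond : PBond P j) :
    Function.updateFinset xext Λ (expFibreChartSU Λ u₀
        (fun b' : ↥Λ => (WithLp.toLp 2 fun a : Fin (dimSU N) => (0 : ↥Λ × Fin (dimSU N) → ℝ) (b', a) : ChartSU N)))
        bond =
      Function.updateFinset xext Λ (fun b' : ↥Λ => u₀ (b' : PBond P j)) bond := by
  have h0 : (fun b' : ↥Λ => (WithLp.toLp 2 fun a : Fin (dimSU N) => (0 : ↥Λ × Fin (dimSU N) → ℝ) (b', a) :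
      ChartSU N)) = 0 := by
    funext b'
    ext a
    simp
  rw [h0]
  by_cases hb : bond ∈ Λ
  · simp only [Function.updateFinset, hb, dif_pos, expFibreChartSU_apply, Pi.zero_apply, expPtSU_zero, mul_one]
  · simp only [Function.updateFinset, hb, dif_neg, not_false_eq_true]

end Summit.QuantumFields.YangMills.Theorems.N21ResponseRoadAtSUNBlockChart
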